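import Literature.Computability.FineGrained.SchoeningMachineScan
import Literature.Computability.Complexity.StackRoutines
import HarnessLib

/-!
# Schöning's random walk for k-SAT, V: the stack machine — one lazy step

Topic `Literature/Computability/FineGrained`, sequel of `SchoeningMachineScan.lean` (same
register conventions). This file programs and verifies **one lazy step** `stepBody k` of the
walk, i.e. the function `stepAssg` of `SchoeningAlgorithm.lean` together with the success
flag:

* `readK k` — pop `k` coins from `w2` (an exhausted register reads `false`, `takePad`),
  recognising the one-hot pattern on the fly: `hd = flag (oneHot ω).isSome` and, if the
  single set coin is the `i`-th, `uu = 1^i` (`rdFold`, `rdFold_init`);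
* `scan` (previous file) — `he`, `cb` = the first violated clause;
* `select` — walk through the clause in `cb` consuming one unit of `uu` per literal: the
  literal at which `uu` runs out is selected, its index collected into `x`, `ls` raised
  (`selFold`);
* `flipSel` — if a literal was selected, the assignment pass in mode `flip` negates its
  variable in `f2`;
* `stepBody k` — all of it, with the bookkeeping of the three outcomes (no violated clause:
  raise the answer flag `o`; no valid selection: discard; selection: flip):
  `runs_stepBody` — `f2` becomes the code of `stepAssg F al (takePad k c)`, `w2` loses `k`
  coins, `o` becomes `flag (fd || good F al)`, every other register is restored.

## References

* U. Schöning, FOCS 1999; F. V. Fomin, D. Kratsch, *Exact Exponential Algorithms*, Springer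
  2010, Fig. 8.2 (the step: pick a literal of a violated clause at random and flip it).
  [SchoeningFOCS1999] [FominKratsch2010]
* T. Nipkow, G. Klein, *Concrete Semantics with Isabelle/HOL*, Springer 2014, Ch. 7.
-/

namespace Literature.Computability.FineGrained.Schoening

open Complexity Complexity.Com LightSearch _root_.Computability

/-! ### Reading `k` coins: the one-hot pattern -/

/-- On a set coin at position `j`: a second set coin lowers `hd` (invalid); the first one
raises `cc` and `hd` and records the position `j` in unary on `uu`. [folklore] -/
def rdOnTrue (j : ℕ) : Com R :=
  popFlag .cc (.push .cc true ;; clear .hd) (.push .cc true ;; .push .hd true ;; pushN .uu true j)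

/-- Pop `n` coins starting at position `j` (an empty coin register reads `false`). [folklore] -/
def readFrom (j : ℕ) : ℕ → Com R
  | 0 => .skip
  | n + 1 => .pop .w2 (rdOnTrue j) .skip .skip ;; readFrom (j + 1) n

/-- Pop `k` coins, then drop the auxiliary flag `cc`. [folklore] -/
def readK (k : ℕ) : Com R := readFrom 0 k ;; clear .cc

/-- Functional model of one coin: the state is (`cc` = a set coin was seen, `hd` = exactly one
so far, `uu` = its position in unary). [folklore] -/
def rdStep (j : ℕ) (b : Bool) (st : Bool × Bool × ℕ) : Bool × Bool × ℕ :=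
  if b then (if st.1 then (true, false, st.2.2) else (true, true, j)) else st

/-- Functional model of `readFrom j` on the coins `ω`. [folklore] -/
def rdFold : ℕ → List Bool → Bool × Bool × ℕ → Bool × Bool × ℕ
  | _, [], st => st
  | j, b :: ω, st => rdFold (j + 1) ω (rdStep j b st)

/-- After a set coin, `hd` only records whether all further coins are unset. [folklore] -/
theorem rdFold_true (hd : Bool) (u : ℕ) : ∀ (j : ℕ) (ω : List Bool),
    rdFold j ω (true, hd, u) = (true, hd && ω.all (fun b => !b), u)
  | j, [] => by simp [rdFold]
  | j, b :: ω => by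
    rw [rdFold, rdStep]
    cases b
    · simp [rdFold_true hd u (j + 1) ω]
    · simp [rdFold_true false u (j + 1) ω]

/-- The position recorded for the coins `ω` read from position `j`: the position of the first
set coin (and `0` if there is none). [folklore] -/
def posJ : ℕ → List Bool → ℕ
  | _, [] => 0
  | j, true :: _ => j
  | j, false :: ω => posJ (j + 1) ω

/-- **`readFrom` recognises the one-hot pattern**: from the initial state the flags end as
`cc = [some coin is set]`, `hd = (oneHot ω).isSome`, position `posJ j ω`. [folklore] -/
theorem rdFold_init : ∀ (j : ℕ) (ω : List Bool),
    rdFold j ω (false, false, 0) = (ω.any id, (oneHot ω).isSome, posJ j ω)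
  | j, [] => by simp [rdFold, oneHot, posJ]
  | j, true :: ω => by
    rw [rdFold, rdStep, if_pos rfl, if_neg (by simp), rdFold_true]
    simp only [oneHot, posJ, Bool.true_and, List.any_cons, id, Bool.true_or]
    by_cases h : ω.all (fun b => !b) = true <;> simp [h]
  | j, false :: ω => by
    rw [rdFold, rdStep, if_neg (by simp), rdFold_init (j + 1) ω]
    simp [oneHot, posJ, Option.isSome_map]

/-- The recorded position of a one-hot pattern is the position of its set coin. [folklore] -/
theorem posJ_eq_of_oneHot : ∀ (j : ℕ) (ω : List Bool) {i : ℕ}, oneHot ω = some i → posJ j ω = j + i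
  | j, [], i, h => by simp [oneHot] at h
  | j, true :: ω, i, h => by
    simp only [oneHot] at h
    split_ifs at h
    simp only [Option.some.injEq] at h
    subst h; simp [posJ]
  | j, false :: ω, i, h => by
    simp only [oneHot] at h
    cases hω : oneHot ω with
    | none => rw [hω] at h; simp at h
    | some i' =>
      rw [hω, Option.map_some, Option.some.injEq] at h
      subst h
      rw [posJ, posJ_eq_of_oneHot (j + 1) ω hω]
      omega

/-- The recorded position is less than `j + |ω|` (or `0`). [folklore] -/
theorem posJ_le : ∀ (j : ℕ) (ω : List Bool), posJ j ω ≤ j + ω.length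
  | j, [] => by simp [posJ]
  | j, true :: ω => by simp [posJ]
  | j, false :: ω => by have := posJ_le (j + 1) ω; simp [posJ] at this ⊢; omega

/-- `rdOnTrue j` follows `rdStep j true`; within `j + 8` steps. [folklore] -/
theorem runs_rdOnTrue (j : ℕ) (cc hd : Bool) (u : ℕ) (hcons : cc = false → hd = false ∧ u = 0) (ρ : RF) :
    Runs (rdOnTrue j) (mk { ρ with cc := flag cc, hd := flag hd, uu := List.replicate u true })
      (mk { ρ with
            cc := flag (rdStep j true (cc, hd, u)).1, hd := flag (rdStep j true (cc, hd, u)).2.1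
            uu := List.replicate (rdStep j true (cc, hd, u)).2.2 true }) (j + 8) := by
  unfold rdOnTrue
  rw [show j + 8 = (j + 6) + 2 by omega]
  refine runs_popFlag (b := cc) (by simp) (fun hcc => ?_) (fun hcc => ?_)
  · subst hcc
    rw [update_mk_cc]
    have a : Runs (.push R.cc true) (mk { ρ with cc := [], hd := flag hd, uu := List.replicate u true })
        (mk { ρ with cc := [true], hd := flag hd, uu := List.replicate u true }) 1 := Runs.push' (by simp)
    have b := runs_clear R.hd (mk { ρ with cc := [true], hd := flag hd, uu := List.replicate u true })
    refine (a.seq b).of_eq ?_ ?_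
    · simp [rdStep]
    · have := length_flag_le hd; simp; omega
  · subst hcc
    have a : Runs (.push R.cc true) (mk { ρ with cc := flag false, hd := flag hd, uu := List.replicate u true })
        (mk { ρ with cc := [true], hd := flag hd, uu := List.replicate u true }) 1 := Runs.push' (by simp)
    have a' : Runs (.push R.hd true) (mk { ρ with cc := [true], hd := flag hd, uu := List.replicate u true })
        (mk { ρ with cc := [true], hd := true :: flag hd, uu := List.replicate u true }) 1 := Runs.push' (by simp)
    have b := runs_pushN R.uu true j (mk { ρ with cc := [true], hd := true :: flag hd, uu := List.replicate u true })
    refine (a.seq (a'.seq b)).of_eq ?_ ?_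
    · obtain ⟨h1, h2⟩ := hcons rfl
      subst h1 h2
      simp [rdStep]
    · omega

/-- **`readFrom j n` on the coins**: `n` coins are popped (`takePad` semantics) and folded by
`rdFold`; within `n (j + n + 10)` steps. [folklore] -/
theorem runs_readFrom : ∀ (n j : ℕ) (c : List Bool) (cc hd : Bool) (u : ℕ), (cc = false → hd = false ∧ u = 0) → ∀ (ρ : RF),
    Runs (readFrom j n) (mk { ρ with w2 := c, cc := flag cc, hd := flag hd, uu := List.replicate u true })
      (mk { ρ with
            w2 := c.drop n
            cc := flag (rdFold j (takePad n c) (cc, hd, u)).1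
            hd := flag (rdFold j (takePad n c) (cc, hd, u)).2.1
            uu := List.replicate (rdFold j (takePad n c) (cc, hd, u)).2.2 true }) (n * (j + n + 10))
  | 0, j, c, cc, hd, u, _, ρ => (Runs.skip _).of_eq (by simp [takePad, rdFold]) (by simp)
  | n + 1, j, c, cc, hd, u, hcons, ρ => by
    rw [readFrom]
    -- the first coin
    have hfirst : ∀ b : Bool, ∀ c' : List Bool, c = b :: c' ∨ (c = [] ∧ b = false ∧ c' = []) →
        Runs (.pop .w2 (rdOnTrue j) .skip .skip)
          (mk { ρ with w2 := c, cc := flag cc, hd := flag hd, uu := List.replicate u true })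
          (mk { ρ with
                w2 := c', cc := flag (rdStep j b (cc, hd, u)).1, hd := flag (rdStep j b (cc, hd, u)).2.1
                uu := List.replicate (rdStep j b (cc, hd, u)).2.2 true }) (j + 8 + 2) := by
      intro b c' hc
      rcases hc with rfl | ⟨rfl, rfl, rfl⟩
      · cases b
        · refine (Runs.pop_false' _ _ (by simp) (update_mk_w2 _ c') (Runs.skip _)).of_eq ?_ (by omega)
          simp [rdStep]
        · exact Runs.pop_true' _ _ (by simp) (update_mk_w2 _ c') (runs_rdOnTrue j cc hd u hcons { ρ with w2 := c' })
      · refine (Runs.pop_nil _ _ (by simp) (Runs.skip _)).of_eq ?_ (by omega)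
        simp [rdStep]
    have htp : ∀ b : Bool, ∀ c' : List Bool, c = b :: c' ∨ (c = [] ∧ b = false ∧ c' = []) →
        takePad (n + 1) c = b :: takePad n c' ∧ c.drop (n + 1) = c'.drop n := by
      intro b c' hc
      rcases hc with rfl | ⟨rfl, rfl, rfl⟩
      · refine ⟨?_, by simp⟩
        rw [takePad, takePad, List.cons_append, List.take_succ_cons, List.replicate_succ', ← List.append_assoc,
          List.take_append_of_le_length (by simp)]
      · refine ⟨?_, by simp⟩
        simp [takePad, List.replicate_succ]
    obtain ⟨b, c', hc⟩ : ∃ b c', c = b :: c' ∨ (c = [] ∧ b = false ∧ c' = []) := by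
      cases c with
      | nil => exact ⟨false, [], Or.inr ⟨rfl, rfl, rfl⟩⟩
      | cons b c' => exact ⟨b, c', Or.inl rfl⟩
    have h1 := hfirst b c' hc
    have h2 := runs_readFrom n (j + 1) c' (rdStep j b (cc, hd, u)).1 (rdStep j b (cc, hd, u)).2.1
      (rdStep j b (cc, hd, u)).2.2 (by revert hcons; unfold rdStep; cases b <;> cases cc <;> cases hd <;> simp) ρ
    obtain ⟨e1, e2⟩ := htp b c' hc
    refine (h1.seq h2).of_eq ?_ ?_
    · simp [e1, e2, rdFold]
    · ring_nf; nlinarith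

/-- **`readK k`**: pop the block `ω = takePad k c` of `k` coins; `hd = flag (oneHot ω).isSome`,
`uu = 1^{posJ 0 ω}` (the selected position when `hd`), `cc` dropped; within `k (k + 10) + 3`
steps. [folklore] -/
theorem runs_readK (k : ℕ) (c : List Bool) (ρ : RF) :
    Runs (readK k) (mk { ρ with w2 := c, cc := [], hd := [], uu := [] })
      (mk { ρ with
            w2 := c.drop k, cc := [], hd := flag (oneHot (takePad k c)).isSome
            uu := List.replicate (posJ 0 (takePad k c)) true }) (k * (k + 10) + 3) := by
  unfold readK
  have h1 := runs_readFrom k 0 c false false 0 (fun _ => ⟨rfl, rfl⟩) ρ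
  rw [rdFold_init] at h1
  simp only [flag_false, List.replicate_zero, zero_add] at h1
  have h2 := runs_clear R.cc (mk { ρ with
    w2 := c.drop k, cc := flag ((takePad k c).any id), hd := flag (oneHot (takePad k c)).isSome
    uu := List.replicate (posJ 0 (takePad k c)) true })
  refine (h1.seq h2).of_eq (by simp) ?_
  have := length_flag_le ((takePad k c).any id)
  simp; omega

/-! ### Selecting the literal -/

/-- The index of the `i`-th literal of a clause (empty beyond the clause). [folklore] -/
def idxAt (C : Clause (List Bool)) (i : ℕ) : List Bool :=
  match C[i]? with
  | some l => l.1
  | none => []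

/-- At the first token of a literal: a unit left on `uu` means "not this literal" (mode
`[false]`); otherwise, if no literal was selected yet (`ls` down), select this one (mode
`[true]`, run `onSel`), else skip it. [folklore] -/
def slDecide (onSel : Com R) : Com R :=
  .pop .uu (.push .md false) (.push .md false)
    (popFlag .ls (.push .ls true ;; .push .md false) (.push .ls true ;; .push .md true ;; onSel))

/-- Handler of an index bit: inside the selected literal collect it on `xr`. [folklore] -/
def slBit (b : Bool) : Com R :=
  .pop .md (.push .md true ;; .push .xr b) (.push .md false) (slDecide (.push .xr b))

/-- Handler of the end of a literal: the selected literal's index goes from `xr` to `x`; a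
literal without index bits is decided here (and the mode dropped again). [folklore] -/
def slPol : Com R :=
  .pop .md (pour .xr .x) .skip (slDecide .skip ;; .pop .md .skip .skip .skip)

/-- The handlers of the selection pass (the clause code ends with `endc`, ignored). [folklore] -/
def slH : Handlers := ⟨slBit, fun _ => slPol, .skip, .skip, .skip, .skip, .skip⟩

/-- The handlers by token. [folklore] -/
theorem slH_run (t : Tok) : slH.run t =
    (match t with
      | .bit b => slBit b
      | .pol _ => slPol
      | _ => .skip) := by
  cases t <;> rfl

/-- **The selection pass** over the clause register `cb`, then drop the unused units.
[folklore] -/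
def select : Com R := tokLoop .cb slH ;; clear .uu

/-- The decision at a literal start: (units left, selected flag, this literal is the selected
one). [folklore] -/
def decRes (u : ℕ) (sel : Bool) : ℕ × Bool × Bool :=
  match u with
  | u' + 1 => (u', sel, false)
  | 0 => (0, true, !sel)

/-- Functional model: the state (units left, selected?, selected index) after one literal.
[folklore] -/
def selStep (l : Literal (List Bool)) (st : ℕ × Bool × List Bool) : ℕ × Bool × List Bool :=
  ((decRes st.1 st.2.1).1, (decRes st.1 st.2.1).2.1, if (decRes st.1 st.2.1).2.2 then l.1 else st.2.2)

/-- Functional model of the pass over a clause. [folklore] -/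
def selFold (c : Clause (List Bool)) (st : ℕ × Bool × List Bool) : ℕ × Bool × List Bool :=
  c.foldl (fun st l => selStep l st) st

/-- `selFold` on a cons. [folklore] -/
@[simp] theorem selFold_cons (l : Literal (List Bool)) (c : Clause (List Bool)) (st : ℕ × Bool × List Bool) :
    selFold (l :: c) st = selFold c (selStep l st) := rfl

/-- `selFold` on nil. [folklore] -/
@[simp] theorem selFold_nil (st : ℕ × Bool × List Bool) : selFold [] st = st := rfl

/-- Once selected with no units left, nothing changes. [folklore] -/
theorem selFold_zero_true (c : Clause (List Bool)) (x : List Bool) : selFold c (0, true, x) = (0, true, x) := by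
  induction c with
  | nil => rfl
  | cons l c ih => rw [selFold_cons, selStep]; simpa [decRes] using ih

/-- **The selection pass picks the `i`-th literal**: from `(i, false, [])` the fold ends with
no units, "selected iff `i < |c|`" and the index `idxAt c i`. [folklore] -/
theorem selFold_eq : ∀ (c : Clause (List Bool)) (i : ℕ),
    selFold c (i, false, []) = (i - c.length, decide (i < c.length), idxAt c i)
  | [], i => by simp [idxAt]
  | l :: c, 0 => by
    rw [selFold_cons, selStep]
    simp [decRes, selFold_zero_true, idxAt]
  | l :: c, i + 1 => by
    rw [selFold_cons, selStep]
    simp only [decRes, Bool.false_eq_true, ↓reduceIte]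
    rw [selFold_eq c i]
    simp [idxAt]

/-- `slDecide` with a unit left: not this literal; `3` steps. [folklore] -/
theorem runs_slDecide_succ (onSel : Com R) (u : ℕ) (sel : Bool) (ρ : RF) :
    Runs (slDecide onSel) (mk { ρ with uu := List.replicate (u + 1) true, ls := flag sel, md := [] })
      (mk { ρ with uu := List.replicate u true, ls := flag sel, md := [false] }) 3 := by
  unfold slDecide
  exact (Runs.pop_true' _ _ (by simp [List.replicate_succ]) (update_mk_uu _ (List.replicate u true))
    (Runs.push' rfl)).of_eq (by simp) (by omega)

/-- `slDecide` with no unit left and a literal already selected: not this one; `6` steps.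
[folklore] -/
theorem runs_slDecide_zero_true (onSel : Com R) (ρ : RF) :
    Runs (slDecide onSel) (mk { ρ with uu := [], ls := [true], md := [] })
      (mk { ρ with uu := [], ls := [true], md := [false] }) 6 := by
  unfold slDecide
  rw [show (6 : ℕ) = ((1 + 1) + 2) + 2 by rfl]
  refine Runs.pop_nil _ _ (by simp) ?_
  exact runs_popFlag (b := true) (by simp) (fun _ => by
    rw [update_mk_ls]; exact ((Runs.push' rfl).seq (Runs.push' rfl)).of_eq (by simp) le_rfl) (fun h => by simp at h)

/-- `slDecide` with no unit left and nothing selected yet: select, run `onSel`; `B + 6` steps.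
[folklore] -/
theorem runs_slDecide_zero_false {onSel : Com R} (ρ : RF) {R' : Regs R} {B : ℕ}
    (hon : Runs onSel (mk { ρ with uu := [], ls := [true], md := [true] }) R' B) :
    Runs (slDecide onSel) (mk { ρ with uu := [], ls := [], md := [] }) R' (B + 6) := by
  unfold slDecide
  rw [show B + 6 = ((1 + (1 + B)) + 2) + 2 by omega]
  refine Runs.pop_nil _ _ (by simp) ?_
  exact runs_popFlag (b := false) (by simp) (fun h => by simp at h) (fun _ =>
    (Runs.push' rfl).seq ((Runs.push' rfl).seq (hon.of_eq_init (by simp))))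

/-- **`slDecide` in the functional model**: the state `(uu, ls)` becomes `decRes`, the mode
records the decision, and `onSel = push xr b` / `skip` contributes `[b]` / nothing to `xr` when
selected; `7` steps. [folklore] -/
theorem runs_slDecide (ob : Option Bool) (u : ℕ) (sel : Bool) (xr : List Bool) (ρ : RF) :
    Runs (slDecide (match ob with | some b => .push .xr b | none => .skip))
      (mk { ρ with uu := List.replicate u true, ls := flag sel, md := [], xr := xr })
      (mk { ρ with
            uu := List.replicate (decRes u sel).1 true, ls := flag (decRes u sel).2.1, md := [(decRes u sel).2.2]
            xr := (if (decRes u sel).2.2 then ob.toList else []) ++ xr }) 7 := by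
  cases u with
  | succ u' => exact (runs_slDecide_succ _ u' sel { ρ with xr := xr }).of_eq (by simp [decRes]) (by omega)
  | zero =>
    cases sel
    · have hon : Runs (match ob with | some b => Com.push R.xr b | none => .skip)
          (mk { { ρ with xr := xr } with uu := [], ls := [true], md := [true] })
          (mk { ρ with uu := [], ls := [true], md := [true], xr := ob.toList ++ xr }) 1 := by
        cases ob with
        | none => exact (Runs.skip _).of_eq (by simp) (by omega)
        | some b => exact (Runs.push' rfl).of_eq (by simp) le_rfl
      exact (runs_slDecide_zero_false { ρ with xr := xr } hon).of_eq (by simp [decRes]) (by omega)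
    · exact (runs_slDecide_zero_true _ { ρ with xr := xr }).of_eq (by simp [decRes]) (by omega)

/-- **The index bits of a literal in the selection pass** (continuation-passing form), by mode:
selected (`md = [true]`, bits collected on `xr`) or not (`md = [false]`); `15` steps per bit.
[folklore] -/
theorem runs_slBits_mode (m : Bool) : ∀ (ys xr rest : List Bool) (ρ : RF) {R₂ : Regs R} {B₂ : ℕ},
    Runs (tokLoop .cb slH)
      (mk { ρ with cb := rest, md := [m], xr := (if m then ys.reverse else []) ++ xr }) R₂ B₂ →
    Runs (tokLoop .cb slH) (mk { ρ with cb := bits (ys.map Tok.bit) ++ rest, md := [m], xr := xr }) R₂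
      (15 * ys.length + B₂)
  | [], xr, rest, ρ, R₂, B₂, hcont => by
    refine (hcont.of_eq_init ?_).mono (by simp)
    cases m <;> simp
  | b :: ys, xr, rest, ρ, R₂, B₂, hcont => by
    have h1 : Runs (slBit b) (mk { ρ with cb := bits (ys.map Tok.bit) ++ rest, md := [m], xr := xr })
        (mk { ρ with cb := bits (ys.map Tok.bit) ++ rest, md := [m], xr := (if m then [b] else []) ++ xr }) 5 := by
      unfold slBit
      cases m
      · refine (Runs.pop_false' _ _ (by simp) (update_mk_md _ []) (Runs.push' rfl)).of_eq (by simp) (by omega)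
      · refine (Runs.pop_true' _ _ (by simp) (update_mk_md _ []) ((Runs.push' rfl).seq (Runs.push' rfl))).of_eq
          (by simp) (by omega)
    have h2 := runs_slBits_mode m ys ((if m then [b] else []) ++ xr) rest ρ (R₂ := R₂) (B₂ := B₂)
      (hcont.of_eq_init (by cases m <;> simp))
    have h := runs_tokLoop_cons (k := R.cb) (H := slH) (t := .bit b) (rest := bits (ys.map Tok.bit) ++ rest)
      (Rg := mk { ρ with cb := bits ((b :: ys).map Tok.bit) ++ rest, md := [m], xr := xr })
      (by simp) (by rw [slH_run]; exact h1.of_eq_init (by simp)) h2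
    exact h.of_eq rfl (by simp; omega)

/-- `slPol` closing a literal whose bits were read in mode `m` (`xr` holds them reversed when
selected): the selected index lands in `x`; `3 |ys| + 3` steps. [folklore] -/
theorem runs_slPol_mode (m : Bool) (ys x : List Bool) (hx : m = true → x = []) (ρ : RF) :
    Runs slPol (mk { ρ with md := [m], xr := (if m then ys.reverse else []), x := x })
      (mk { ρ with md := [], xr := [], x := (if m then ys else x) }) (3 * ys.length + 3) := by
  unfold slPol
  cases m
  · exact (Runs.pop_false' _ _ (by simp) (update_mk_md _ []) (Runs.skip _)).of_eq (by simp) (by omega)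
  · have p := runs_pour (a := R.xr) (b := R.x) (by decide) (mk { ρ with md := [], xr := ys.reverse, x := x })
    refine (Runs.pop_true' _ _ (by simp) (update_mk_md _ []) p).of_eq ?_ ?_
    · simp [hx rfl]
    · simp

/-- `slPol` at a literal without index bits: decided here, mode dropped again; the selected
index is empty; `11` steps. [folklore] -/
theorem runs_slPol_start (u : ℕ) (sel : Bool) (x : List Bool) (hx : sel = false → x = []) (ρ : RF) :
    Runs slPol (mk { ρ with md := [], xr := [], x := x, uu := List.replicate u true, ls := flag sel })
      (mk { ρ with
            md := [], xr := [], x := (if (decRes u sel).2.2 then [] else x)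
            uu := List.replicate (decRes u sel).1 true, ls := flag (decRes u sel).2.1 }) 11 := by
  unfold slPol
  refine Runs.pop_nil _ _ (by simp) ?_
  have hd := runs_slDecide none u sel [] { ρ with x := x }
  refine ((hd.of_eq_init (by simp)).seq (B₂ := 2) ?_).of_eq rfl (by omega)
  cases hm : (decRes u sel).2.2
  · exact (Runs.pop_false' _ _ (by simp) (update_mk_md _ []) (Runs.skip _)).of_eq (by simp) le_rfl
  · have hsel : sel = false := by
      revert hm; unfold decRes; cases u <;> cases sel <;> simp
    exact (Runs.pop_true' _ _ (by simp) (update_mk_md _ []) (Runs.skip _)).of_eq (by simp [hx hsel]) le_rfl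

/-- **One literal in the selection pass** (continuation-passing form): from a literal start
(`md` down, `xr` empty) the state `(uu, ls, x)` becomes `selStep`; within `18 |y| + 30`
steps. [folklore] -/
theorem runs_slLit (l : Literal (List Bool)) (u : ℕ) (sel : Bool) (x rest : List Bool)
    (hx : sel = false → x = []) (ρ : RF) {R₂ : Regs R} {B₂ : ℕ}
    (hcont : Runs (tokLoop .cb slH)
      (mk { ρ with
            cb := rest, md := [], xr := []
            uu := List.replicate (selStep l (u, sel, x)).1 true, ls := flag (selStep l (u, sel, x)).2.1
            x := (selStep l (u, sel, x)).2.2 }) R₂ B₂) :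
    Runs (tokLoop .cb slH)
      (mk { ρ with cb := bits (eToks l) ++ rest, md := [], xr := [], uu := List.replicate u true, ls := flag sel, x := x })
      R₂ (18 * l.1.length + 30 + B₂) := by
  obtain ⟨ys, v⟩ := l
  simp only [eToks, bits_append, bits_cons, bits_nil, List.append_nil, List.append_assoc] at hcont ⊢
  cases ys with
  | nil =>
    -- a literal without index bits: decided at its `pol`
    simp only [List.map_nil, bits_nil, List.nil_append] at hcont ⊢
    have h1 := runs_slPol_start u sel x hx { ρ with cb := rest }
    have h := runs_tokLoop_cons (k := R.cb) (H := slH) (t := .pol v) (rest := rest)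
      (Rg := mk { ρ with cb := (Tok.pol v).code ++ rest, md := [], xr := [], uu := List.replicate u true, ls := flag sel, x := x })
      (by simp) (by rw [slH_run]; exact h1.of_eq_init (by simp)) (hcont.of_eq_init (by simp [selStep]))
    exact h.of_eq rfl (by simp)
  | cons b ys =>
    set m : Bool := (decRes u sel).2.2 with hm
    -- the first bit decides
    have h1 : Runs (slBit b) (mk { ρ with
          cb := bits (ys.map Tok.bit) ++ ((Tok.pol v).code ++ rest), md := [], xr := [], uu := List.replicate u true
          ls := flag sel, x := x })
        (mk { ρ with
          cb := bits (ys.map Tok.bit) ++ ((Tok.pol v).code ++ rest), md := [m], xr := (if m then [b] else [])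
          uu := List.replicate (decRes u sel).1 true, ls := flag (decRes u sel).2.1, x := x }) (7 + 2) := by
      unfold slBit
      refine Runs.pop_nil _ _ (by simp) ?_
      have hd := runs_slDecide (some b) u sel [] { ρ with cb := bits (ys.map Tok.bit) ++ ((Tok.pol v).code ++ rest), x := x }
      exact (hd.of_eq_init (by simp)).of_eq (by simp [hm]) le_rfl
    -- the closing `pol`
    have h3 : Runs (tokLoop .cb slH)
        (mk { ρ with
          cb := (Tok.pol v).code ++ rest, md := [m], xr := (if m then ys.reverse else []) ++ (if m then [b] else [])
          uu := List.replicate (decRes u sel).1 true, ls := flag (decRes u sel).2.1, x := x }) R₂ (3 * (ys.length + 1) + 3 + 10 + B₂) := by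
      have hx' : m = true → x = [] := fun hmt => hx (by
        revert hmt; rw [hm]; unfold decRes; cases u <;> cases sel <;> simp)
      have hp := runs_slPol_mode m (b :: ys) x hx'
        { ρ with cb := rest, uu := List.replicate (decRes u sel).1 true, ls := flag (decRes u sel).2.1 }
      refine runs_tokLoop_cons (t := .pol v) (rest := rest) (by simp) (by
        rw [slH_run]; exact hp.of_eq_init (by cases m <;> simp)) (hcont.of_eq_init ?_)
      simp [selStep, ← hm]
    have h2 := runs_slBits_mode m ys (if m then [b] else []) ((Tok.pol v).code ++ rest)
      { ρ with uu := List.replicate (decRes u sel).1 true, ls := flag (decRes u sel).2.1, x := x } (R₂ := R₂)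
      (B₂ := 3 * (ys.length + 1) + 3 + 10 + B₂) (h3.of_eq_init (by simp))
    have h := runs_tokLoop_cons (k := R.cb) (H := slH) (t := .bit b)
      (rest := bits (ys.map Tok.bit) ++ ((Tok.pol v).code ++ rest))
      (Rg := mk { ρ with
        cb := (Tok.bit b).code ++ (bits (List.map Tok.bit ys) ++ ((Tok.pol v).code ++ rest)), md := [], xr := []
        uu := List.replicate u true, ls := flag sel, x := x })
      (by simp) (by rw [slH_run]; exact h1.of_eq_init (by simp)) (h2.of_eq_init (by simp))
    exact h.of_eq rfl (by simp; omega)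

/-- The selected index is empty unless a literal was selected. [folklore] -/
theorem selStep_x_eq_nil (l : Literal (List Bool)) (u : ℕ) (sel : Bool) (x : List Bool) (hx : sel = false → x = [])
    (h : (selStep l (u, sel, x)).2.1 = false) : (selStep l (u, sel, x)).2.2 = [] := by
  revert h; unfold selStep decRes
  cases u with
  | succ u' => simpa using hx
  | zero => cases sel <;> simp

/-- **The literals of a clause in the selection pass** (continuation-passing form); within
`30 |code c|` steps. [folklore] -/
theorem runs_slLits : ∀ (c : Clause (List Bool)) (u : ℕ) (sel : Bool) (x rest : List Bool) (ρ : RF)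
    {R₂ : Regs R} {B₂ : ℕ},
    Runs (tokLoop .cb slH)
      (mk { ρ with
            cb := rest, md := [], xr := []
            uu := List.replicate (selFold c (u, sel, x)).1 true, ls := flag (selFold c (u, sel, x)).2.1
            x := (selFold c (u, sel, x)).2.2 }) R₂ B₂ →
    (sel = false → x = []) →
    Runs (tokLoop .cb slH)
      (mk { ρ with cb := bits (aToks c) ++ rest, md := [], xr := [], uu := List.replicate u true, ls := flag sel, x := x })
      R₂ (30 * (bits (aToks c)).length + B₂)
  | [], u, sel, x, rest, ρ, R₂, B₂, hcont, _ => by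
    refine (hcont.of_eq_init ?_).mono (by simp)
    simp
  | l :: c, u, sel, x, rest, ρ, R₂, B₂, hcont, hx => by
    have h2 := runs_slLits c (selStep l (u, sel, x)).1 (selStep l (u, sel, x)).2.1 (selStep l (u, sel, x)).2.2 rest ρ
      (R₂ := R₂) (B₂ := B₂) (hcont.of_eq_init (by simp)) (selStep_x_eq_nil l u sel x hx)
    have h1 := runs_slLit l u sel x (bits (aToks c) ++ rest) hx ρ h2
    refine (h1.of_eq_init (by simp)).mono ?_
    simp only [aToks_cons, bits_append, List.length_append, length_bits_eToks]
    omega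

/-- **The selection pass** on `cb = code C` with `uu = 1^i`: `ls = flag (i < |C|)`,
`x = idxAt C i`, `cb`, `uu` consumed; within `30 |code C| + 2 i + 14` steps. [folklore] -/
theorem runs_select (C : Clause (List Bool)) (i : ℕ) (ρ : RF) :
    Runs select (mk { ρ with cb := bits (cToks C), md := [], xr := [], uu := List.replicate i true, ls := [], x := [] })
      (mk { ρ with cb := [], md := [], xr := [], uu := [], ls := flag (decide (i < C.length)), x := idxAt C i })
      (30 * (bits (cToks C)).length + 2 * i + 14) := by
  unfold select
  rw [show bits (cToks C) = bits (aToks C) ++ (Tok.endc.code ++ []) by simp [cToks]]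
  set st := selFold C (i, false, []) with hst
  -- the final `endc` is skipped, then the loop exits
  have hend : Runs (tokLoop .cb slH)
      (mk { ρ with cb := Tok.endc.code ++ [], md := [], xr := [], uu := List.replicate st.1 true, ls := flag st.2.1, x := st.2.2 })
      (mk { ρ with cb := [], md := [], xr := [], uu := List.replicate st.1 true, ls := flag st.2.1, x := st.2.2 })
      (0 + 10 + 1) :=
    runs_tokLoop_cons (t := .endc) (rest := []) (by simp) (by
      rw [slH_run]; exact (Runs.skip _).of_eq (by simp) le_rfl) (runs_tokLoop_nil (by simp))
  have h1 := runs_slLits C i false [] (Tok.endc.code ++ []) ρ hend (fun _ => rfl)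
  have h2 := runs_clear R.uu
    (mk { ρ with cb := [], md := [], xr := [], uu := List.replicate st.1 true, ls := flag st.2.1, x := st.2.2 })
  refine (h1.seq h2).of_eq ?_ ?_
  · rw [hst, selFold_eq]; simp
  · rw [hst, selFold_eq]; simp; omega

/-! ### Flipping the selected variable -/

/-- If a literal was selected (`ls`), negate its variable in the assignment (mode `flip` of the
assignment pass); clear the query. [folklore] -/
def flipSel : Com R := popFlag .ls (lookup .flip) .skip ;; clear .x

/-- **`flipSel`**: `f2` becomes the code of `flipKey al x` if `ls` was up, stays otherwise;
`ls`, `x` cleared; within `(23 |x| + 95) |code al| + 2 |x| + 5` steps. [folklore] -/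
theorem runs_flipSel (sel : Bool) (x : List Bool) (al : Assg) (ρ : RF) :
    Runs flipSel
      (mk { ρ with ls := flag sel, x := x, md := [], xc := [], mis := [], t := [], u := [], f2r := [], f2 := bits (aToks al) })
      (mk { ρ with
            ls := [], x := [], md := [], xc := [], mis := [], t := [], u := [], f2r := []
            f2 := bits (aToks (if sel then flipKey al x else al)) }) ((23 * x.length + 95) * (bits (aToks al)).length + 2 * x.length + 5) := by
  unfold flipSel
  set ρ₀ : RF := { ρ with ls := flag sel, x := x, md := [], xc := [], mis := [], t := [], u := [], f2r := [], f2 := bits (aToks al) }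
    with hρ₀
  have h1 : Runs (popFlag .ls (lookup .flip) .skip) (mk ρ₀)
      (mk { ρ₀ with ls := [], f2 := bits (aToks (if sel then flipKey al x else al)) })
      ((23 * x.length + 95) * (bits (aToks al)).length + 2 + 2) := by
    refine runs_popFlag (B := (23 * x.length + 95) * (bits (aToks al)).length + 2) (b := sel) (by simp [hρ₀])
      (fun hs => ?_) (fun hs => ?_)
    · subst hs
      have h := runs_lookup .flip al false x { ρ with ls := [] }
      rw [luOut_flip, luFlag_flip] at h
      exact (h.of_eq (by simp [hρ₀]) le_rfl).of_eq_init (by simp [hρ₀])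
    · subst hs
      exact (Runs.skip _).of_eq (by simp [hρ₀]) (by omega)
  have h2 := runs_clear R.x (mk { ρ₀ with ls := [], f2 := bits (aToks (if sel then flipKey al x else al)) })
  refine (h1.seq h2).of_eq (by simp [hρ₀]) ?_
  simp [hρ₀]; omega

/-! ### The step -/

/-- **One lazy step of the walk**: read `k` coins, scan for the first violated clause; if
there is none raise the answer flag `o`; otherwise, if exactly one coin is set, select the
corresponding literal of the clause and flip its variable; in all cases restore the scratch
registers. (Fomin–Kratsch 2010, Fig. 8.2, lazy version; `stepAssg`.)
[cite: FominKratsch2010, Fig. 8.2 (random-walk)] -/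
def stepBody (k : ℕ) : Com R :=
  readK k ;; scan ;;
  popFlag .he
    (popFlag .hd (select ;; flipSel) (clear .uu ;; clear .cb))
    (setFlag .o ;; clear .hd ;; clear .uu)

/-- The cost of one step on a formula of code length `Lf` with an assignment of code length
`La` (reading, scanning, then selecting and flipping with indices of length `≤ Lf`).
[folklore] -/
def stepCost (k Lf La : ℕ) : ℕ :=
  k * (k + 10) + 3 + (105 * (La + 1) * Lf + 3 * Lf + 2) + ((23 * Lf + 95) * La + 32 * Lf + 2 * k + 19 + 2) + 2

/-- From a violated clause the assignment is not good. [folklore] -/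
theorem good_eq_false_of_firstViolated {F : CNF (List Bool)} {al : Assg} {C : Clause (List Bool)}
    (h : firstViolated F al = some C) : good F al = false := by
  cases hg : good F al
  · rfl
  · rw [← firstViolated_eq_none_iff] at hg; rw [hg] at h; exact absurd h (by simp)

/-- **The step follows `stepAssg`.** From the rest state with `f = code F`, `f2 = code al`,
coins `c` on `w2`, answer flag `o = flag fd`: afterwards `w2 = c.drop k`,
`f2 = code (stepAssg F al (takePad k c))`, `o = flag (fd || good F al)`, every other
register as before; within `stepCost k |code F| |code al|` steps, provided indices and clause
codes are no longer than the formula code (as for the clauses of `F` itself). [folklore] -/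
theorem runs_stepBody (k : ℕ) (F : CNF (List Bool)) (al : Assg) (c : List Bool) (fd : Bool) (ρ : RF)
    (hidx : ∀ C ∈ F, ∀ l ∈ C, l.1.length ≤ (bits (fToks F)).length)
    (hlen : ∀ C ∈ F, (bits (cToks C)).length ≤ (bits (fToks F)).length) :
    Runs (stepBody k)
      (mk { ρ with
            w2 := c, f := bits (fToks F), f2 := bits (aToks al), o := flag fd
            fr := [], lb := [], xr := [], x := [], ls := [], sat := [], he := [], cb := [], hd := [], cc := [], uu := []
            md := [], xc := [], mis := [], t := [], u := [], f2r := [] })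
      (mk { ρ with
            w2 := c.drop k, f := bits (fToks F), f2 := bits (aToks (stepAssg F al (takePad k c))), o := flag (fd || good F al)
            fr := [], lb := [], xr := [], x := [], ls := [], sat := [], he := [], cb := [], hd := [], cc := [], uu := []
            md := [], xc := [], mis := [], t := [], u := [], f2r := [] })
      (stepCost k (bits (fToks F)).length (bits (aToks al)).length) := by
  unfold stepBody
  set ω := takePad k c with hω
  set i := posJ 0 ω with hi
  have hik : i ≤ k := by
    have := posJ_le 0 ω; rw [hω, length_takePad] at this; simpa [hi, hω] using this
  set ρ₀ : RF := { ρ with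
    w2 := c, f := bits (fToks F), f2 := bits (aToks al), o := flag fd
    fr := [], lb := [], xr := [], x := [], ls := [], sat := [], he := [], cb := [], hd := [], cc := [], uu := []
    md := [], xc := [], mis := [], t := [], u := [], f2r := [] } with hρ₀
  -- read the coins, scan
  have h1 := runs_readK k c ρ₀
  set ρ₁ : RF := { ρ₀ with w2 := c.drop k, cc := [], hd := flag (oneHot ω).isSome, uu := List.replicate i true } with hρ₁
  have h2 := runs_scan F al ρ₁
  set ρ₂ : RF := { ρ₁ with he := flag (firstViolated F al).isSome, cb := scanOut F al } with hρ₂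
  set ρ₃ : RF := { ρ₂ with
    he := [], hd := [], uu := [], cb := [], f2 := bits (aToks (stepAssg F al ω)), o := flag (fd || good F al) } with hρ₃
  set B₁ := (23 * (bits (fToks F)).length + 95) * (bits (aToks al)).length + 32 * (bits (fToks F)).length + 2 * k + 19
    with hB₁
  -- the three outcomes
  have h3 : Runs (popFlag .he (popFlag .hd (select ;; flipSel) (clear .uu ;; clear .cb)) (setFlag .o ;; clear .hd ;; clear .uu))
      (mk ρ₂) (mk ρ₃) (B₁ + 2 + 2) := by
    refine runs_popFlag (B := B₁ + 2) (b := (firstViolated F al).isSome) (by simp [hρ₂]) (fun hfv => ?_) (fun hfv => ?_)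
    · -- a violated clause `C`
      obtain ⟨C, hC⟩ := Option.isSome_iff_exists.1 hfv
      have hCF : C ∈ F := (mem_of_firstViolated hC).1
      have hso : scanOut F al = bits (cToks C) := by simp [scanOut, hC]
      have hg : good F al = false := good_eq_false_of_firstViolated hC
      have hcl := hlen C hCF
      have inner : Runs (popFlag .hd (select ;; flipSel) (clear .uu ;; clear .cb)) (mk { ρ₂ with he := [] }) (mk ρ₃) (B₁ + 2) := by
        refine runs_popFlag (B := B₁) (b := (oneHot ω).isSome) (by simp [hρ₂, hρ₁]) (fun hoh => ?_) (fun hoh => ?_)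
        · -- a valid selection `i`
          obtain ⟨i', hi'⟩ := Option.isSome_iff_exists.1 hoh
          have hii : i = i' := by rw [hi, posJ_eq_of_oneHot 0 ω hi', zero_add]
          have hs := runs_select C i { ρ₂ with he := [], hd := [] }
          have hf := runs_flipSel (decide (i < C.length)) (idxAt C i) al { ρ₂ with he := [], hd := [], cb := [], uu := [] }
          have hstep : stepAssg F al ω = (if decide (i < C.length) then flipKey al (idxAt C i) else al) := by
            by_cases hlt : i < C.length
            · have hget : C[i]? = some C[i] := List.getElem?_eq_getElem hlt
              rw [stepAssg_of_get_some hC (hii ▸ hi') hget]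
              simp [hlt, idxAt]
            · have hget : C[i]? = none := List.getElem?_eq_none (by omega)
              rw [stepAssg_of_get_none hC (hii ▸ hi') hget]
              simp [hlt]
          have hxl : (idxAt C i).length ≤ (bits (fToks F)).length := by
            unfold idxAt
            cases hget : C[i]? with
            | none => simp
            | some l => exact hidx C hCF l (List.mem_of_getElem? hget)
          refine (((hs.of_eq_init ?_).seq (hf.of_eq_init ?_)).of_eq ?_ ?_)
          · simp [hρ₂, hρ₁, hρ₀, hso]
          · simp [hρ₂, hρ₁, hρ₀]
          · rw [hρ₃, hstep]; simp [hρ₂, hρ₁, hρ₀, hg]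
          · rw [hB₁]
            nlinarith [hxl, hcl, hik, Nat.zero_le (bits (aToks al)).length, Nat.zero_le (bits (fToks F)).length,
              Nat.zero_le (idxAt C i).length]
        · -- no valid selection: discard
          have hnone : oneHot ω = none := Option.not_isSome_iff_eq_none.1 (by simp [hoh])
          have a := runs_clear R.uu (mk { ρ₂ with he := [], hd := [] })
          have b := runs_clear R.cb (mk { ρ₂ with he := [], hd := [], uu := [] })
          refine (((a.of_eq (by simp [hρ₂]) le_rfl).seq b).of_eq ?_ ?_).of_eq_init (by simp [hρ₂, hρ₁, hoh])
          · rw [hρ₃, stepAssg_of_oneHot_none hnone]; simp [hρ₂, hρ₁, hρ₀, hg]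
          · simp only [hρ₂, hρ₁, hρ₀, mk_uu, mk_cb, List.length_replicate, hso]
            nlinarith [hcl, hik]
      exact inner.of_eq_init (by simp [hρ₂])
    · -- no violated clause: success
      have hnone : firstViolated F al = none := Option.not_isSome_iff_eq_none.1 (by simp [hfv])
      have hg : good F al = true := (firstViolated_eq_none_iff F al).1 hnone
      have hso : scanOut F al = [] := by simp [scanOut, hnone]
      have a := runs_setFlag R.o (mk ρ₂) (by cases fd <;> simp [hρ₂, hρ₁, hρ₀])
      have b := runs_clear R.hd (Function.update (mk ρ₂) R.o [true])
      have d := runs_clear R.uu (Function.update (Function.update (mk ρ₂) R.o [true]) R.hd [])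
      refine (a.seq (b.seq d)).of_eq ?_ ?_
      · rw [hρ₃, stepAssg_of_none hnone]
        simp [hρ₂, hρ₁, hρ₀, hg, hso, hfv]
      · have := length_flag_le (oneHot ω).isSome
        simp only [hρ₂, hρ₁, hρ₀, update_mk_o, update_mk_hd, mk_hd, mk_uu, List.length_replicate]
        nlinarith [this, hik]
  refine ((h1.of_eq_init (by simp [hρ₀])).seq ((h2.of_eq_init (by simp [hρ₁, hρ₀])).seq
    (h3.of_eq_init (by simp [hρ₂, hρ₁, hρ₀])))).of_eq ?_ ?_
  · simp [hρ₃, hρ₂, hρ₁, hρ₀, hω]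
  · simp only [stepCost, hB₁]
    omega

end Literature.Computability.FineGrained.Schoening
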